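import Summits.BirchSwinnertonDyer.BirchSwinnertonDyer.Theorems.CMKolyvaginAtInertTwoShaCountJacobiHeegnerAtTwo
import HarnessLib

/-!
# Route `CMKolyvaginAtInertTwo`, crux `CMKolyvaginExactAtInertTwo` (stmt-BirchSwinnertonDyer-24277):
# THE COUNT IDENTITY, XVI — `(Δ_min / |d_K|) = sign Δ` for EVERY odd Heegner `d_K` (Jacobi symbol,
# composite `|d_K|` allowed), by reciprocity alone

Seat `bsd-line-cmk2-p1` g15 (cell `bsd-print-cf2`); helper (`--supports stmt-BirchSwinnertonDyer-24277`).
THEOREMS ONLY: no definition, no named fact, no `sorry`; no item is closed; BSD is not proved by this.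

File X proved `(Δ_min/q) = sign Δ` for a PRIME `|d_K| = q` with Legendre symbols. The same
reciprocity argument works for the Jacobi symbol at any odd `|d_K|` (`≡ 3 (mod 4)`): a bad prime
`p ∣ N` splits in `K`, so `(d_K/p) = 1`; for odd `p` this is `(|d_K|/p) = (−1/p)` and Jacobi
reciprocity (`|d_K| ≡ 3 (mod 4)`) gives `(p/|d_K|) = (−1/p)² = 1`; for `p = 2`, `d_K ≡ 1 (mod 8)` and
`(2/|d_K|) = χ₈(|d_K|) = 1`. Multiplicativity over the prime factors of `Δ_min` (all bad) gives
`(|Δ_min| / |d_K|) = 1`, hence `(Δ_min/|d_K|) = χ₄(|d_K|)^{[Δ<0]} = sign Δ`. Consequently, for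
composite `d_K = −q₁⋯q_g`, the local symbols `(Δ/q_i)` entering file XV's defect
`Σ_i ([(Δ/q_i) = −1] + 2[(Δ/q_i) = 1 ∧ a_{q_i} even])` multiply to `sign Δ` — when `Δ < 0` at least
one `q_i` has `(Δ/q_i) = −1` (the defect is `≥ 1`, as integrality of the identity demands).

* (private) `(p / |d_K|) = 1` for `p ∣ N`, and `(Δ_min / |d_K|) = sign Δ` — the statements of file X
  with the primality binder dropped (kept private: the tree's restatement lint identifies them with
  file X's prime versions);
* `jacobiSym_num_Δ_natAbs_discr_of_heegner` — **`(W.Δ.num / |d_K|) = if Δ < 0 then −1 else 1`** for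
  every odd Heegner `d_K` (the currency `W.Δ.num = Δ_min` of files XIV/XV);
* `exists_jacobiSym_num_Δ_eq_neg_one_of_Δ_neg_of_heegner`, `one_le_sum_defect_of_Δ_neg_of_heegner` —
  for `Δ < 0` some prime `q ∣ d_K` has `(Δ/q) = −1`, so the defect of file XV is `≥ 1`.
-/

-- single-conjunct summit: `Summit.BirchSwinnertonDyer.BirchSwinnertonDyer.…` repeats the name by design
set_option linter.dupNamespace false
set_option autoImplicit false

noncomputable section

open scoped Classical

open WeierstrassCurve NumberField Literature.NumberTheory.EllipticCurves
  Literature.NumberTheory.QuadraticFields Summit.BirchSwinnertonDyer.Rank1Residual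

namespace Summit.BirchSwinnertonDyer.BirchSwinnertonDyer.Theorems.ShaCountTwo

section Heegner

variable (W : WeierstrassCurve ℚ) [W.IsElliptic] [W.IsGloballyMinimal]
  (K : Type) [Field K] [NumberField K] (hK : IsImaginaryQuadratic K)
  (hodd : Odd (NumberField.discr K)) (hH : SatisfiesHeegnerHypothesis (W.conductorNorm ℤ) K)

omit [W.IsElliptic] [W.IsGloballyMinimal] in
include hK hodd hH in
/-- **`(p / |d_K|) = 1` (Jacobi symbol) for every prime `p ∣ N` and every odd Heegner `d_K`.** The
bad prime `p` splits in `K` (Heegner hypothesis). If `p = 2`: `d_K ≡ 1 (mod 8)`, so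
`|d_K| ≡ 7 (mod 8)` and `(2/|d_K|) = χ₈(|d_K|) = 1`. If `p` is odd: `(d_K/p) = 1`, i.e.
`(|d_K|/p) = (−1/p) = χ₄(p)`; `|d_K| ≡ 3 (mod 4)`, so Jacobi reciprocity gives `(p/|d_K|) = (|d_K|/p)`
if `p ≡ 1 (4)` and `−(|d_K|/p)` if `p ≡ 3 (4)` — `1` in both cases. The prime-`|d_K|` version is
file X's `legendreSym_natAbs_discr_eq_one_of_prime_dvd_conductorNorm`. [folklore] -/
private theorem jacobiSym_natAbs_discr_eq_one_of_prime_dvd_conductorNorm' {p : ℕ} (hp : p.Prime)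
    (hpN : p ∣ W.conductorNorm ℤ) : jacobiSym (p : ℤ) (NumberField.discr K).natAbs = 1 := by
  set q : ℕ := (NumberField.discr K).natAbs with hq_def
  haveI hpF : Fact p.Prime := ⟨hp⟩
  have h2 : Module.finrank ℚ K = 2 := hK.1
  have hq4 : q % 4 = 3 := natAbs_discr_mod_four K hK hodd
  have hqodd : Odd q := by rw [Nat.odd_iff]; omega
  have hDq : NumberField.discr K = -(q : ℤ) := discr_eq_neg_natAbs K hK
  have hsplit : ((Ideal.span {(p : ℤ)}).primesOver (𝓞 K)).ncard = 2 := hH p hp hpN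
  by_cases hp2 : p = 2
  · -- `2 ∣ N`: `d_K ≡ 1 (mod 8)`, `|d_K| ≡ 7 (mod 8)`, `(2/|d_K|) = 1`
    have hsplit2 : ((Ideal.span {(2 : ℤ)}).primesOver (𝓞 K)).ncard = 2 := by
      rw [hp2] at hsplit
      exact_mod_cast hsplit
    have h8 : NumberField.discr K % 8 = 1 := (Quadratic.ncard_primesOver_two_eq_two_iff h2).mp hsplit2
    have hq8 : q % 8 = 7 := by omega
    rw [hp2, Nat.cast_ofNat, jacobiSym.at_two hqodd, ZMod.χ₈_nat_eq_if_mod_eight]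
    have : q % 2 ≠ 0 := by omega
    simp [this, hq8]
  · -- odd `p`: `(−|d_K|/p) = 1`, Jacobi reciprocity
    have hleg : legendreSym p (NumberField.discr K) = 1 :=
      (Quadratic.ncard_primesOver_eq_two_iff_legendreSym h2 hp2).mp hsplit
    rw [hDq] at hleg
    have hmul : legendreSym p (-(q : ℤ)) = legendreSym p (-1) * legendreSym p q := by
      rw [← legendreSym.mul]; ring_nf
    rw [hmul, legendreSym.at_neg_one hp2] at hleg
    rcases Nat.odd_mod_four_iff.mp (hp.eq_two_or_odd.resolve_left hp2) with hp1 | hp3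
    · -- `p ≡ 1 (4)`: `(|d_K|/p) = 1`, `(p/|d_K|) = (|d_K|/p)`
      rw [ZMod.χ₄_nat_one_mod_four hp1, one_mul, jacobiSym.legendreSym.to_jacobiSym] at hleg
      rw [jacobiSym.quadratic_reciprocity_one_mod_four hp1 hqodd]
      exact hleg
    · -- `p ≡ 3 (4)`: `(|d_K|/p) = -1`, `(p/|d_K|) = -(|d_K|/p)`
      rw [ZMod.χ₄_nat_three_mod_four hp3, neg_one_mul, jacobiSym.legendreSym.to_jacobiSym] at hleg
      rw [jacobiSym.quadratic_reciprocity_three_mod_four hp3 hq4]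
      linear_combination hleg

include hK hodd hH in
/-- **`(Δ_min / |d_K|) = sign Δ_min` for every odd Heegner `d_K`** (`W/ℚ` globally minimal; `K`
imaginary quadratic with `d_K` odd, every prime of `N(W)` split in `K`): every prime factor of
`Δ_min` is bad, hence divides `N`, hence has `(p/|d_K|) = 1`; so `(|Δ_min| / |d_K|) = 1` and
`(Δ_min/|d_K|) = χ₄(|d_K|)^{[Δ<0]} = (if Δ < 0 then −1 else 1)` (`|d_K| ≡ 3 (mod 4)`). The prime case is
file X's `jacobiSym_minimalDiscriminantInt_natAbs_discr`. [folklore] -/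
private theorem jacobiSym_minimalDiscriminantInt_natAbs_discr' :
    jacobiSym (minimalDiscriminantInt W) (NumberField.discr K).natAbs = if W.Δ < 0 then -1 else 1 := by
  set q : ℕ := (NumberField.discr K).natAbs with hq_def
  have hq4 : q % 4 = 3 := natAbs_discr_mod_four K hK hodd
  set Δm : ℤ := minimalDiscriminantInt W with hΔm_def
  have hcast : (Δm : ℚ) = W.Δ := cast_minimalDiscriminantInt W
  have hΔ0 : Δm ≠ 0 := by
    intro h
    have : W.Δ = 0 := by rw [← hcast, h, Int.cast_zero]
    exact W.Δ'.ne_zero (by rw [coe_Δ']; exact this)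
  -- `(|Δ_min| / |d_K|) = 1`
  have habs : jacobiSym (Δm.natAbs : ℤ) q = 1 := by
    refine jacobiSym_natCast_eq_one_of_forall_prime q (Int.natAbs_ne_zero.mpr hΔ0) fun p hp hpΔ ↦ ?_
    haveI : Fact p.Prime := ⟨hp⟩
    have hpΔ' : (p : ℤ) ∣ Δm := Int.dvd_natAbs.mp (Int.natCast_dvd_natCast.mpr hpΔ)
    have hbad : ¬ W.HasGoodReductionAtPrime p := fun hgood ↦
      not_dvd_minimalDiscriminantInt_of_hasGoodReductionAtPrime' W p hgood hpΔ'
    exact jacobiSym_natAbs_discr_eq_one_of_prime_dvd_conductorNorm' W K hK hodd hH hp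
      ((W.dvd_conductorNorm_iff_not_hasGoodReductionAtPrime p).mpr hbad)
  have hqodd : Odd q := by rw [Nat.odd_iff]; omega
  by_cases hneg : W.Δ < 0
  · rw [if_pos hneg]
    have hΔneg : Δm < 0 := by
      have : (Δm : ℚ) < 0 := by rw [hcast]; exact hneg
      exact_mod_cast this
    have hΔeq : Δm = -(Δm.natAbs : ℤ) := by
      rw [Int.ofNat_natAbs_of_nonpos hΔneg.le, neg_neg]
    rw [hΔeq, jacobiSym.neg _ hqodd, habs, mul_one, ZMod.χ₄_nat_three_mod_four hq4]
  · rw [if_neg hneg]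
    have hΔpos : 0 ≤ Δm := by
      have : (0 : ℚ) ≤ Δm := by rw [hcast]; exact not_lt.mp hneg
      exact_mod_cast this
    have hΔeq : Δm = (Δm.natAbs : ℤ) := (Int.natAbs_of_nonneg hΔpos).symm
    rw [hΔeq, habs]

include hK hodd hH in
/-- `(Δ / |d_K|) = sign Δ` in the currency `W.Δ.num` of files XIV/XV (`W` globally minimal, so
`W.Δ.num = Δ_min`), every odd Heegner `d_K`. [folklore] -/
theorem jacobiSym_num_Δ_natAbs_discr_of_heegner :
    jacobiSym W.Δ.num (NumberField.discr K).natAbs = if W.Δ < 0 then -1 else 1 := by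
  have hnum : W.Δ.num = minimalDiscriminantInt W := by
    rw [← cast_minimalDiscriminantInt W, Rat.num_intCast]
  rw [hnum, jacobiSym_minimalDiscriminantInt_natAbs_discr' W K hK hodd hH]

end Heegner

/-! ## The defect of file XV is positive when `Δ < 0` -/

/-- If no prime `q ∣ b` has `J(a | q) = −1`, then `J(a | b) ≠ −1` (multiplicativity in the
denominator; the values at primes are then `0` or `1`). [folklore] -/
theorem jacobiSym_ne_neg_one_of_forall_prime (a : ℤ) {b : ℕ}
    (h : ∀ q : ℕ, q.Prime → q ∣ b → jacobiSym a q ≠ -1) : jacobiSym a b ≠ -1 := by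
  induction b using Nat.strong_induction_on with
  | _ b ih =>
    rcases Nat.lt_or_ge b 2 with hlt | hge
    · interval_cases b
      · rw [jacobiSym.zero_right]; norm_num
      · rw [jacobiSym.one_right]; norm_num
    · set p := b.minFac with hp_def
      have hp : p.Prime := Nat.minFac_prime (by omega)
      obtain ⟨m, hm⟩ : p ∣ b := Nat.minFac_dvd b
      have hb0 : b ≠ 0 := by omega
      have hm0 : m ≠ 0 := by
        rintro rfl
        rw [mul_zero] at hm
        exact hb0 hm
      have hmlt : m < b := by
        rw [hm]
        exact lt_mul_left (Nat.pos_of_ne_zero hm0) hp.one_lt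
      have hJp := h p hp ⟨m, hm⟩
      have hJm := ih m hmlt fun r hr hrm ↦ h r hr (hm ▸ Dvd.dvd.mul_left hrm p)
      rw [hm, jacobiSym.mul_right' a hp.ne_zero hm0]
      rcases jacobiSym.trichotomy a p with h0 | h1 | h2
      · rw [h0, zero_mul]; norm_num
      · rw [h1, one_mul]; exact hJm
      · exact absurd h2 hJp

section Defect

variable (W : WeierstrassCurve ℚ) [W.IsElliptic] [W.IsGloballyMinimal]
  (K : Type) [Field K] [NumberField K] (hK : IsImaginaryQuadratic K)
  (hodd : Odd (NumberField.discr K)) (hH : SatisfiesHeegnerHypothesis (W.conductorNorm ℤ) K)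

include hK hodd hH in
/-- **For `Δ < 0` some prime `q ∣ d_K` has `(Δ/q) = −1`** (every odd Heegner `d_K`): the symbols
`(Δ/q)`, `q ∣ |d_K|`, multiply to `(Δ/|d_K|) = −1`. [folklore] -/
theorem exists_jacobiSym_num_Δ_eq_neg_one_of_Δ_neg_of_heegner (hΔ : W.Δ < 0) :
    ∃ q ∈ (NumberField.discr K).natAbs.primeFactors, jacobiSym W.Δ.num q = -1 := by
  have hJ : jacobiSym W.Δ.num (NumberField.discr K).natAbs = -1 := by
    rw [jacobiSym_num_Δ_natAbs_discr_of_heegner W K hK hodd hH, if_pos hΔ]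
  by_contra hne
  push Not at hne
  refine jacobiSym_ne_neg_one_of_forall_prime W.Δ.num (fun q hq hqd ↦ hne q ?_) hJ
  rw [Nat.mem_primeFactors]
  exact ⟨hq, hqd, Int.natAbs_ne_zero.mpr (NumberField.discr_ne_zero K)⟩

include hK hodd hH in
/-- **The Tamagawa defect of file XV is `≥ 1` when `Δ < 0`:**
`1 ≤ Σ_{q ∣ d_K} ([(Δ/q) = −1] + 2·[(Δ/q) = 1 ∧ a_q even])` — as the integrality of
`ord₂ #Ш(E_K) + 1 = [Δ > 0] + ord₂ #Ш(E) + ord₂ #Ш(E^{(d_K)}) + Σ` demands. [folklore] -/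
theorem one_le_sum_defect_of_Δ_neg_of_heegner (hΔ : W.Δ < 0) :
    1 ≤ ∑ q ∈ (NumberField.discr K).natAbs.primeFactors,
      ((if jacobiSym W.Δ.num q = -1 then 1 else 0) +
        (if jacobiSym W.Δ.num q = 1 ∧ Even (W.frobeniusTrace q) then 2 else 0)) := by
  obtain ⟨q, hq, hJ⟩ := exists_jacobiSym_num_Δ_eq_neg_one_of_Δ_neg_of_heegner W K hK hodd hH hΔ
  refine le_trans ?_ (Finset.single_le_sum (f := fun q ↦
    ((if jacobiSym W.Δ.num q = -1 then 1 else 0) +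
      (if jacobiSym W.Δ.num q = 1 ∧ Even (W.frobeniusTrace q) then 2 else 0))) (fun _ _ ↦ Nat.zero_le _) hq)
  simp only [hJ, if_true]
  omega

end Defect

end Summit.BirchSwinnertonDyer.BirchSwinnertonDyer.Theorems.ShaCountTwo

end
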